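import Summits.ValiantsHypothesis.ValiantsHypothesis.Theorems.LacunarySymmetroidMatrixDescartesPivotRankOneCriticalWindowsLoneFoldAlgebra
import Summits.ValiantsHypothesis.ValiantsHypothesis.Theorems.LacunarySymmetroidMatrixDescartesPivotRankOneCriticalWindowsFourBranchDeriv

/-!
# `MatrixDescartes` census — rank-one `(2,K)₁`, lone letter: THE BRANCH FUNCTION OF A POSITIVE FEWNOMIAL, FOR ANY NUMBER OF LETTERS

HONEST FRAMING.  Object-search cell `pub-symmetroid`, seat `val-sym-mdr-p1` (generation 24); helper file `--supports` the crux item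
stmt-ValiantsHypothesis-18050 (`Theses.LacunarySymmetroid.MatrixDescartes`, OPEN, on HOLD) with NO closure claim.  The all-`K` replacement of
`…FourBranchZero.branch0_function` / `…FourBranchDeriv.branch0_hasDerivAt` (generation 22): for each direction `T` of the window, the `j`-free
combination `F(T,x) = ∑ₘ wₘx^{dₘ}Nₘ(T)` of the two critical equations (`Nₘ` the `j`-minors of `…LoneFoldAlgebra`) has exactly ONE positive root
`x = φ(T)` — the pivot coefficient is the only negative one and carries the smallest exponent — and `φ` is differentiable, with the
implicit-differentiation formula.  DIFFERENCE FROM `K = 4`: continuity of `φ` is obtained from UNIQUENESS through the implicit function theorem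
(the local implicit branch is positive near the point, hence coincides with `φ`), not from monotonicity in `T` — so no window Wronskian is needed
and the number of letters is arbitrary.  No count; nothing on `MatrixDescartes` in its window, `DoorA26`/`DoorA34`, registers / credences, `VP ≠ VNP`.

* §1 `fewnomial_root_exists` / `fewnomial_root_unique` / `fewnomial_xderiv_pos` — `∑ cₘx^{dₘ}` with `cₚ < 0 ≤ cₘ` (`m ≠ p`), some `cₘ > 0`, and
  `dₚ < dₘ` (`m ≠ p`): exactly one positive root, at which `∑ dₘcₘx^{dₘ} > 0`. [folklore]
* §2 `continuousAt_of_implicit_unique`, `implicit_hasDerivAt_of_unique` — GENERIC: a positive solution branch that is unique among positive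
  solutions is continuous, hence (by `…FourBranchDeriv.implicit_hasDerivAt`) differentiable with derivative `−F_T/F_x`. [folklore]
* **§3 `branch_hasDerivAt`** — the branch function of the lone-letter configuration on a window `(Tₘ, tⱼ)` on which `Nₚ < 0 < Nₘ` (left letters):
  positive, unique, and differentiable with `F_x(T, φ T) > 0`. [folklore]
[folklore] Intermediate value theorem, strict monotonicity of positive fewnomials, Mathlib's bivariate implicit function theorem.  No definitions,
no named facts.
-/

-- `Summit.ValiantsHypothesis.ValiantsHypothesis.…` repeats a component by the D-0017 layout
-- (single-conjunct summit), which the `dupNamespace` linter flags; the name is mandated.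
set_option linter.dupNamespace false

open Filter Topology

namespace Summit.ValiantsHypothesis.ValiantsHypothesis.Theorems.LacunarySymmetroidMatrixDescartes.Pivot.CriticalWindows.Lone

open Finset
open scoped BigOperators

/-! ## 1. Positive fewnomials with one negative coefficient at the smallest exponent -/

/-- Normalised form: `∑ cₘx^{dₘ} = x^{dₚ}·∑ cₘx^{dₘ−dₚ}` when `dₚ ≤ dₘ` for all `m`. [folklore] -/
theorem fewnomial_normalise {ι : Type*} (s : Finset ι) (c : ι → ℝ) (d : ι → ℕ) (p : ι) (x : ℝ)
    (hd : ∀ m ∈ s, d p ≤ d m) :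
    ∑ m ∈ s, c m * x ^ d m = x ^ d p * ∑ m ∈ s, c m * x ^ (d m - d p) := by
  rw [Finset.mul_sum]
  refine Finset.sum_congr rfl fun m hm => ?_
  rw [← pow_mul_pow_sub x (hd m hm)]
  ring

/-- The normalised fewnomial is strictly increasing on `(0, ∞)`: for `0 < x < y`,
`∑ cₘx^{dₘ−dₚ} < ∑ cₘy^{dₘ−dₚ}` when `cₘ ≥ 0` off the pivot, some `cₘ > 0`, and `dₚ < dₘ` off the pivot. [folklore] -/
theorem fewnomial_normalised_strictMono {ι : Type*} (s : Finset ι) (c : ι → ℝ) (d : ι → ℕ) (p : ι) {x y : ℝ}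
    (hc : ∀ m ∈ s, m ≠ p → 0 ≤ c m) (hm₀ : ∃ m ∈ s, m ≠ p ∧ 0 < c m) (hd : ∀ m ∈ s, m ≠ p → d p < d m)
    (hx : 0 < x) (hxy : x < y) :
    ∑ m ∈ s, c m * x ^ (d m - d p) < ∑ m ∈ s, c m * y ^ (d m - d p) := by
  have hle : ∀ m ∈ s, c m * x ^ (d m - d p) ≤ c m * y ^ (d m - d p) := by
    intro m hm
    by_cases hmp : m = p
    · rw [hmp, Nat.sub_self, pow_zero, pow_zero]
    · exact mul_le_mul_of_nonneg_left (pow_le_pow_left₀ hx.le hxy.le _) (hc m hm hmp)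
  obtain ⟨m₀, hm₀s, hm₀p, hc₀⟩ := hm₀
  have hlt : c m₀ * x ^ (d m₀ - d p) < c m₀ * y ^ (d m₀ - d p) := by
    refine mul_lt_mul_of_pos_left (pow_lt_pow_left₀ hxy hx.le ?_) hc₀
    exact Nat.sub_ne_zero_of_lt (hd m₀ hm₀s hm₀p)
  exact Finset.sum_lt_sum hle ⟨m₀, hm₀s, hlt⟩

/-- **EXISTENCE OF A POSITIVE ROOT.** [folklore] -/
theorem fewnomial_root_exists {ι : Type*} (s : Finset ι) (c : ι → ℝ) (d : ι → ℕ) (p : ι) (hp : p ∈ s)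
    (hcp : c p < 0) (hc : ∀ m ∈ s, m ≠ p → 0 ≤ c m) (hm₀ : ∃ m ∈ s, m ≠ p ∧ 0 < c m) (hd : ∀ m ∈ s, m ≠ p → d p < d m) :
    ∃ x : ℝ, 0 < x ∧ ∑ m ∈ s, c m * x ^ d m = 0 := by
  classical
  obtain ⟨m₀, hm₀s, hm₀p, hc₀⟩ := hm₀
  -- the normalised fewnomial `G`
  have hG0 : ∑ m ∈ s, c m * (0:ℝ) ^ (d m - d p) = c p := by
    rw [← Finset.add_sum_erase s _ hp, Nat.sub_self, pow_zero, mul_one]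
    have : ∑ m ∈ s.erase p, c m * (0:ℝ) ^ (d m - d p) = 0 := by
      refine Finset.sum_eq_zero fun m hm => ?_
      have hmp : m ≠ p := Finset.ne_of_mem_erase hm
      rw [zero_pow (Nat.sub_ne_zero_of_lt (hd m (Finset.mem_of_mem_erase hm) hmp)), mul_zero]
    rw [this, add_zero]
  set X : ℝ := max 1 (-c p / c m₀) with hX
  have hX1 : 1 ≤ X := le_max_left _ _
  have hXr : -c p / c m₀ ≤ X := le_max_right _ _
  have hGX : 0 ≤ ∑ m ∈ s, c m * X ^ (d m - d p) := by
    -- keep only the `p`-term and the `m₀`-term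
    have hsplit : ∑ m ∈ s, c m * X ^ (d m - d p)
        = c p + (c m₀ * X ^ (d m₀ - d p) + ∑ m ∈ (s.erase p).erase m₀, c m * X ^ (d m - d p)) := by
      rw [← Finset.add_sum_erase s _ hp, Nat.sub_self, pow_zero, mul_one,
        ← Finset.add_sum_erase (s.erase p) _ (Finset.mem_erase.mpr ⟨hm₀p, hm₀s⟩)]
    rw [hsplit]
    have hrest : 0 ≤ ∑ m ∈ (s.erase p).erase m₀, c m * X ^ (d m - d p) := by
      refine Finset.sum_nonneg fun m hm => ?_
      have hm' := Finset.mem_of_mem_erase (Finset.mem_of_mem_erase hm)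
      have hmp : m ≠ p := Finset.ne_of_mem_erase (Finset.mem_of_mem_erase hm)
      exact mul_nonneg (hc m hm' hmp) (pow_nonneg (by linarith) _)
    have hpow : X ≤ X ^ (d m₀ - d p) := by
      calc X = X ^ 1 := (pow_one X).symm
        _ ≤ X ^ (d m₀ - d p) := pow_le_pow_right₀ hX1 (Nat.one_le_iff_ne_zero.mpr (Nat.sub_ne_zero_of_lt (hd m₀ hm₀s hm₀p)))
    have h1 : -c p ≤ c m₀ * X := by
      have := mul_le_mul_of_nonneg_left hXr hc₀.le
      rwa [mul_div_cancel₀ _ hc₀.ne'] at this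
    have h2 : c m₀ * X ≤ c m₀ * X ^ (d m₀ - d p) := mul_le_mul_of_nonneg_left hpow hc₀.le
    linarith
  have hcont : ContinuousOn (fun x : ℝ => ∑ m ∈ s, c m * x ^ (d m - d p)) (Set.Icc 0 X) := by
    exact (continuous_finsetSum s fun m _ => by fun_prop).continuousOn
  have hlo : (fun x : ℝ => ∑ m ∈ s, c m * x ^ (d m - d p)) 0 ≤ 0 := by simp only; rw [hG0]; exact hcp.le
  have hhi : 0 ≤ (fun x : ℝ => ∑ m ∈ s, c m * x ^ (d m - d p)) X := hGX
  obtain ⟨x, ⟨hx0, -⟩, hx⟩ := intermediate_value_Icc (by positivity : (0:ℝ) ≤ X) hcont ⟨hlo, hhi⟩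
  simp only at hx
  have hxpos : 0 < x := by
    rcases lt_or_eq_of_le hx0 with h | h
    · exact h
    · exfalso; rw [← h, hG0] at hx; linarith
  refine ⟨x, hxpos, ?_⟩
  rw [fewnomial_normalise s c d p x (fun m hm => by
    by_cases hmp : m = p
    · rw [hmp]
    · exact (hd m hm hmp).le), hx, mul_zero]

/-- **UNIQUENESS OF THE POSITIVE ROOT.** [folklore] -/
theorem fewnomial_root_unique {ι : Type*} (s : Finset ι) (c : ι → ℝ) (d : ι → ℕ) (p : ι)
    (hc : ∀ m ∈ s, m ≠ p → 0 ≤ c m) (hm₀ : ∃ m ∈ s, m ≠ p ∧ 0 < c m) (hd : ∀ m ∈ s, m ≠ p → d p < d m)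
    {x y : ℝ} (hx : 0 < x) (hy : 0 < y) (hFx : ∑ m ∈ s, c m * x ^ d m = 0) (hFy : ∑ m ∈ s, c m * y ^ d m = 0) :
    x = y := by
  have hdle : ∀ m ∈ s, d p ≤ d m := fun m hm => by
    by_cases hmp : m = p
    · rw [hmp]
    · exact (hd m hm hmp).le
  rw [fewnomial_normalise s c d p x hdle] at hFx
  rw [fewnomial_normalise s c d p y hdle] at hFy
  have hGx : ∑ m ∈ s, c m * x ^ (d m - d p) = 0 := by
    rcases mul_eq_zero.mp hFx with h | h
    · exact absurd h (pow_ne_zero _ hx.ne')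
    · exact h
  have hGy : ∑ m ∈ s, c m * y ^ (d m - d p) = 0 := by
    rcases mul_eq_zero.mp hFy with h | h
    · exact absurd h (pow_ne_zero _ hy.ne')
    · exact h
  rcases lt_trichotomy x y with hlt | heq | hgt
  · have := fewnomial_normalised_strictMono s c d p hc hm₀ hd hx hlt; linarith
  · exact heq
  · have := fewnomial_normalised_strictMono s c d p hc hm₀ hd hy hgt; linarith

/-- **THE EULER DERIVATIVE IS POSITIVE AT THE ROOT.**  At a positive root, `∑ dₘ·cₘ·x^{dₘ} > 0` (it equals `∑ (dₘ−dₚ)cₘx^{dₘ}`, every term `≥ 0`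
and one `> 0`). [folklore] -/
theorem fewnomial_xderiv_pos {ι : Type*} (s : Finset ι) (c : ι → ℝ) (d : ι → ℕ) (p : ι)
    (hc : ∀ m ∈ s, m ≠ p → 0 ≤ c m) (hm₀ : ∃ m ∈ s, m ≠ p ∧ 0 < c m) (hd : ∀ m ∈ s, m ≠ p → d p < d m)
    {x : ℝ} (hx : 0 < x) (hF : ∑ m ∈ s, c m * x ^ d m = 0) :
    0 < ∑ m ∈ s, (d m : ℝ) * c m * x ^ d m := by
  have key : ∑ m ∈ s, (d m : ℝ) * c m * x ^ d m = ∑ m ∈ s, ((d m : ℝ) - d p) * c m * x ^ d m + (d p : ℝ) * ∑ m ∈ s, c m * x ^ d m := by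
    rw [Finset.mul_sum, ← Finset.sum_add_distrib]
    exact Finset.sum_congr rfl fun m _ => by ring
  rw [key, hF, mul_zero, add_zero]
  obtain ⟨m₀, hm₀s, hm₀p, hc₀⟩ := hm₀
  refine Finset.sum_pos' ?_ ⟨m₀, hm₀s, ?_⟩
  · intro m hm
    by_cases hmp : m = p
    · rw [hmp, sub_self, zero_mul, zero_mul]
    · have : (0:ℝ) < (d m : ℝ) - d p := by
        have h := hd m hm hmp
        have : (d p : ℝ) < d m := by exact_mod_cast h
        linarith
      exact mul_nonneg (mul_nonneg this.le (hc m hm hmp)) (pow_nonneg hx.le _)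
  · have : (0:ℝ) < (d m₀ : ℝ) - d p := by
      have h := hd m₀ hm₀s hm₀p
      have : (d p : ℝ) < d m₀ := by exact_mod_cast h
      linarith
    exact mul_pos (mul_pos this hc₀) (pow_pos hx _)

/-! ## 2. Generic: a unique positive implicit branch is continuous, hence differentiable -/

/-- **CONTINUITY FROM UNIQUENESS.**  `F : ℝ → ℝ → ℝ` with everywhere-defined, jointly continuous partial derivatives; `φ > 0` on an open set
`s` with `F(T, φ T) = 0`, and `φ T` the ONLY positive zero of `F(T, ·)` for `T ∈ s`; `F_x(T₀, φ T₀) ≠ 0` at `T₀ ∈ s`.  Then `φ` is continuous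
at `T₀`: the implicit branch through `(T₀, φ T₀)` is positive nearby, hence equals `φ`. [folklore] -/
theorem continuousAt_of_implicit_unique {F FT Fx : ℝ → ℝ → ℝ}
    (hT : ∀ T x : ℝ, HasDerivAt (fun T' => F T' x) (FT T x) T)
    (hx : ∀ T x : ℝ, HasDerivAt (fun x' => F T x') (Fx T x) x)
    (cT : Continuous (fun p : ℝ × ℝ => FT p.1 p.2)) (cx : Continuous (fun p : ℝ × ℝ => Fx p.1 p.2))
    {φ : ℝ → ℝ} {s : Set ℝ} (hs : IsOpen s) (hF0 : ∀ T ∈ s, F T (φ T) = 0) (hpos : ∀ T ∈ s, 0 < φ T)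
    (huniq : ∀ T ∈ s, ∀ x : ℝ, 0 < x → F T x = 0 → x = φ T)
    {T₀ : ℝ} (hT₀ : T₀ ∈ s) (hFx : Fx T₀ (φ T₀) ≠ 0) :
    ContinuousAt φ T₀ := by
  let f₁ : ℝ → ℝ → ℝ →L[ℝ] ℝ := fun T x => (FT T x) • (1 : ℝ →L[ℝ] ℝ)
  let f₂ : ℝ → ℝ → ℝ →L[ℝ] ℝ := fun T x => (Fx T x) • (1 : ℝ →L[ℝ] ℝ)
  have df₁ : ∀ᶠ v in 𝓝 (T₀, φ T₀), HasFDerivAt (F · v.2) (f₁ v.1 v.2) v.1 := by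
    refine Filter.Eventually.of_forall fun v => ?_
    refine (hT v.1 v.2).hasFDerivAt.congr_fderiv ?_
    ext; simp [f₁]
  have df₂ : ∀ᶠ v in 𝓝 (T₀, φ T₀), HasFDerivAt (F v.1 ·) (f₂ v.1 v.2) v.2 := by
    refine Filter.Eventually.of_forall fun v => ?_
    refine (hx v.1 v.2).hasFDerivAt.congr_fderiv ?_
    ext; simp [f₂]
  have cf₁ : ContinuousAt ↿f₁ (T₀, φ T₀) := by
    have : Continuous (↿f₁) := by
      show Continuous fun p : ℝ × ℝ => (FT p.1 p.2) • (1 : ℝ →L[ℝ] ℝ)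
      exact cT.smul continuous_const
    exact this.continuousAt
  have cf₂ : ContinuousAt ↿f₂ (T₀, φ T₀) := by
    have : Continuous (↿f₂) := by
      show Continuous fun p : ℝ × ℝ => (Fx p.1 p.2) • (1 : ℝ →L[ℝ] ℝ)
      exact cx.smul continuous_const
    exact this.continuousAt
  let e : ℝ ≃L[ℝ] ℝ := ContinuousLinearEquiv.equivOfInverse
    ((Fx T₀ (φ T₀)) • (1 : ℝ →L[ℝ] ℝ)) ((Fx T₀ (φ T₀))⁻¹ • (1 : ℝ →L[ℝ] ℝ))
    (fun y => by simp [hFx]) (fun y => by simp [hFx])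
  have he : (e : ℝ →L[ℝ] ℝ) = f₂ (T₀, φ T₀).1 (T₀, φ T₀).2 := by
    ext; simp [e, f₂]
  have if₂u : (f₂ (T₀, φ T₀).1 (T₀, φ T₀).2).IsInvertible := ⟨e, he⟩
  have htend := tendsto_implicitFunctionOfBivariate df₁ df₂ cf₁ cf₂ if₂u
  have happ := eventually_apply_implicitFunctionOfBivariate df₁ df₂ cf₁ cf₂ if₂u
  -- the implicit branch is eventually positive, lies in `s`, and solves `F = 0`; hence equals `φ`
  have hpos₀ : 0 < φ T₀ := hpos T₀ hT₀
  have hev_pos : ∀ᶠ T in 𝓝 T₀, 0 < implicitFunctionOfBivariate df₁ df₂ cf₁ cf₂ if₂u T :=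
    htend.eventually (lt_mem_nhds hpos₀)
  have hev_s : ∀ᶠ T in 𝓝 T₀, T ∈ s := hs.mem_nhds hT₀
  have hev : φ =ᶠ[𝓝 T₀] implicitFunctionOfBivariate df₁ df₂ cf₁ cf₂ if₂u := by
    filter_upwards [hev_pos, hev_s, happ] with T h1 h2 h3
    rw [hF0 T₀ hT₀] at h3
    exact (huniq T h2 _ h1 h3).symm
  have hψ : ContinuousAt (implicitFunctionOfBivariate df₁ df₂ cf₁ cf₂ if₂u) T₀ := by
    have hval : implicitFunctionOfBivariate df₁ df₂ cf₁ cf₂ if₂u T₀ = φ T₀ := by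
      have := hev.self_of_nhds
      exact this.symm
    rw [ContinuousAt, hval]
    exact htend
  exact (hψ.congr hev.symm :)

/-- **DERIVATIVE OF A UNIQUE POSITIVE IMPLICIT BRANCH.**  Under the hypotheses of `continuousAt_of_implicit_unique` at every point of the open
set `s`, `φ` has derivative `−F_T(T₀,φ T₀)/F_x(T₀,φ T₀)` at `T₀`. [folklore] -/
theorem implicit_hasDerivAt_of_unique {F FT Fx : ℝ → ℝ → ℝ}
    (hT : ∀ T x : ℝ, HasDerivAt (fun T' => F T' x) (FT T x) T)
    (hx : ∀ T x : ℝ, HasDerivAt (fun x' => F T x') (Fx T x) x)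
    (cT : Continuous (fun p : ℝ × ℝ => FT p.1 p.2)) (cx : Continuous (fun p : ℝ × ℝ => Fx p.1 p.2))
    {φ : ℝ → ℝ} {s : Set ℝ} (hs : IsOpen s) (hF0 : ∀ T ∈ s, F T (φ T) = 0) (hpos : ∀ T ∈ s, 0 < φ T)
    (huniq : ∀ T ∈ s, ∀ x : ℝ, 0 < x → F T x = 0 → x = φ T) (hFxs : ∀ T ∈ s, Fx T (φ T) ≠ 0)
    {T₀ : ℝ} (hT₀ : T₀ ∈ s) :
    HasDerivAt φ (-(FT T₀ (φ T₀)) / Fx T₀ (φ T₀)) T₀ := by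
  have hφc : ContinuousOn φ s := fun T hTs =>
    (continuousAt_of_implicit_unique hT hx cT cx hs hF0 hpos huniq hTs (hFxs T hTs)).continuousWithinAt
  exact Four.implicit_hasDerivAt hT hx cT cx hs hφc hF0 hT₀ (hFxs T₀ hT₀)

/-! ## 3. The branch function of the lone-letter configuration -/

/-- Derivative of the `j`-minor `Nₘ(T) = βⱼ(T−tⱼ)²(T²−tₘ²) − (T²−tⱼ²)βₘ(T−tₘ)²` in `T`. [folklore] -/
theorem hasDerivAt_minorN (βm βj tm tj T : ℝ) :
    HasDerivAt (fun T' : ℝ => βj * (T' - tj) ^ 2 * (T' ^ 2 - tm ^ 2) - (T' ^ 2 - tj ^ 2) * βm * (T' - tm) ^ 2)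
      (βj * (2 * (T - tj)) * (T ^ 2 - tm ^ 2) + βj * (T - tj) ^ 2 * (2 * T)
        - ((2 * T) * βm * (T - tm) ^ 2 + (T ^ 2 - tj ^ 2) * βm * (2 * (T - tm)))) T := by
  have h1 : HasDerivAt (fun T' : ℝ => (T' - tj) ^ 2) (2 * (T - tj)) T := by
    simpa using ((hasDerivAt_id T).sub_const tj).fun_pow 2
  have h2 : HasDerivAt (fun T' : ℝ => (T' - tm) ^ 2) (2 * (T - tm)) T := by
    simpa using ((hasDerivAt_id T).sub_const tm).fun_pow 2
  have h3 : HasDerivAt (fun T' : ℝ => T' ^ 2 - tm ^ 2) (2 * T) T := by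
    simpa using (hasDerivAt_pow 2 T).sub_const (tm ^ 2)
  have h4 : HasDerivAt (fun T' : ℝ => T' ^ 2 - tj ^ 2) (2 * T) T := by
    simpa using (hasDerivAt_pow 2 T).sub_const (tj ^ 2)
  have hA := (h1.const_mul βj).fun_mul h3
  have hB := (h4.fun_mul (hasDerivAt_const T βm)).fun_mul h2
  refine (hA.fun_sub hB).congr_deriv ?_
  ring

/-- **THE BRANCH FUNCTION (any number of letters).**  Letters `m ∈ s` with base weights `wₘ > 0` and exponents `dₘ`, `dₚ < dₘ` for `m ≠ p`;
rates with `βⱼ`; on a window `(Tₘ, tⱼ)` of directions on which the pivot minor is negative (`Nₚ(T) < 0`), the left minors are positive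
(`Nₘ(T) > 0`, `m ≠ p, j`; at least one left letter) — `Nⱼ ≡ 0`.  Then there is `φ : ℝ → ℝ` with, for every `T` in the window: `φ T > 0` and
`∑ wₘ(φ T)^{dₘ}Nₘ(T) = 0`; any positive `x` with `∑ wₘx^{dₘ}Nₘ(T) = 0` equals `φ T`; `∑ dₘwₘ(φT)^{dₘ−1}Nₘ(T) > 0`; and `φ` has the
implicit derivative `−F_T/F_x` at `T`. [folklore] -/
theorem branch_hasDerivAt {ι : Type*} (s : Finset ι) (β t w : ι → ℝ) (d : ι → ℕ) (p j : ι) (Tm : ℝ)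
    (hp : p ∈ s) (hleft : ∃ m ∈ s, m ≠ p ∧ m ≠ j)
    (hw : ∀ m ∈ s, 0 < w m) (hd : ∀ m ∈ s, m ≠ p → d p < d m)
    (hNp : ∀ T : ℝ, Tm < T → T < t j →
      β j * (T - t j) ^ 2 * (T ^ 2 - t p ^ 2) - (T ^ 2 - t j ^ 2) * β p * (T - t p) ^ 2 < 0)
    (hN : ∀ T : ℝ, Tm < T → T < t j → ∀ m ∈ s, m ≠ p → m ≠ j →
      0 < β j * (T - t j) ^ 2 * (T ^ 2 - t m ^ 2) - (T ^ 2 - t j ^ 2) * β m * (T - t m) ^ 2) :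
    ∃ φ : ℝ → ℝ,
      (∀ T : ℝ, Tm < T → T < t j → 0 < φ T ∧
        ∑ m ∈ s, w m * (φ T) ^ d m * (β j * (T - t j) ^ 2 * (T ^ 2 - t m ^ 2) - (T ^ 2 - t j ^ 2) * β m * (T - t m) ^ 2) = 0) ∧
      (∀ T x : ℝ, Tm < T → T < t j → 0 < x →
        ∑ m ∈ s, w m * x ^ d m * (β j * (T - t j) ^ 2 * (T ^ 2 - t m ^ 2) - (T ^ 2 - t j ^ 2) * β m * (T - t m) ^ 2) = 0 →
        x = φ T) ∧
      (∀ T : ℝ, Tm < T → T < t j →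
        0 < ∑ m ∈ s, w m * ((d m : ℝ) * (φ T) ^ (d m - 1)) *
              (β j * (T - t j) ^ 2 * (T ^ 2 - t m ^ 2) - (T ^ 2 - t j ^ 2) * β m * (T - t m) ^ 2) ∧
        HasDerivAt φ
          (-(∑ m ∈ s, w m * (φ T) ^ d m * (β j * (2 * (T - t j)) * (T ^ 2 - t m ^ 2) + β j * (T - t j) ^ 2 * (2 * T)
              - ((2 * T) * β m * (T - t m) ^ 2 + (T ^ 2 - t j ^ 2) * β m * (2 * (T - t m)))))
            / (∑ m ∈ s, w m * ((d m : ℝ) * (φ T) ^ (d m - 1)) *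
              (β j * (T - t j) ^ 2 * (T ^ 2 - t m ^ 2) - (T ^ 2 - t j ^ 2) * β m * (T - t m) ^ 2))) T) := by
  -- coefficients `cₘ(T) = wₘNₘ(T)`: signs on the window
  have hcoef : ∀ T : ℝ, Tm < T → T < t j →
      w p * (β j * (T - t j) ^ 2 * (T ^ 2 - t p ^ 2) - (T ^ 2 - t j ^ 2) * β p * (T - t p) ^ 2) < 0 ∧
      (∀ m ∈ s, m ≠ p → 0 ≤ w m * (β j * (T - t j) ^ 2 * (T ^ 2 - t m ^ 2) - (T ^ 2 - t j ^ 2) * β m * (T - t m) ^ 2)) ∧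
      (∃ m ∈ s, m ≠ p ∧ 0 < w m * (β j * (T - t j) ^ 2 * (T ^ 2 - t m ^ 2) - (T ^ 2 - t j ^ 2) * β m * (T - t m) ^ 2)) := by
    intro T h1 h2
    refine ⟨mul_neg_of_pos_of_neg (hw p hp) (hNp T h1 h2), ?_, ?_⟩
    · intro m hm hmp
      by_cases hmj : m = j
      · rw [hmj, minorN_lone]; simp
      · exact (mul_pos (hw m hm) (hN T h1 h2 m hm hmp hmj)).le
    · obtain ⟨m₀, hm₀, hm₀p, hm₀j⟩ := hleft
      exact ⟨m₀, hm₀, hm₀p, mul_pos (hw m₀ hm₀) (hN T h1 h2 m₀ hm₀ hm₀p hm₀j)⟩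
  -- rewrite `wₘ x^{dₘ} Nₘ = (wₘNₘ) x^{dₘ}`
  have hrew : ∀ (T x : ℝ), ∑ m ∈ s, w m * x ^ d m * (β j * (T - t j) ^ 2 * (T ^ 2 - t m ^ 2) - (T ^ 2 - t j ^ 2) * β m * (T - t m) ^ 2)
      = ∑ m ∈ s, (w m * (β j * (T - t j) ^ 2 * (T ^ 2 - t m ^ 2) - (T ^ 2 - t j ^ 2) * β m * (T - t m) ^ 2)) * x ^ d m := by
    intro T x; exact Finset.sum_congr rfl fun m _ => by ring
  -- existence for each `T` (choice)
  have hex : ∀ T : ℝ, ∃ x : ℝ, Tm < T → T < t j → (0 < x ∧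
      ∑ m ∈ s, w m * x ^ d m * (β j * (T - t j) ^ 2 * (T ^ 2 - t m ^ 2) - (T ^ 2 - t j ^ 2) * β m * (T - t m) ^ 2) = 0) := by
    intro T
    by_cases h : Tm < T ∧ T < t j
    · obtain ⟨hcp, hc, hm₀⟩ := hcoef T h.1 h.2
      obtain ⟨x, hx, ex⟩ := fewnomial_root_exists s _ d p hp hcp hc hm₀ hd
      exact ⟨x, fun _ _ => ⟨hx, by rw [hrew]; exact ex⟩⟩
    · exact ⟨1, fun h1 h2 => absurd ⟨h1, h2⟩ h⟩
  choose φ hφ using hex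
  have huniq : ∀ T x : ℝ, Tm < T → T < t j → 0 < x →
      ∑ m ∈ s, w m * x ^ d m * (β j * (T - t j) ^ 2 * (T ^ 2 - t m ^ 2) - (T ^ 2 - t j ^ 2) * β m * (T - t m) ^ 2) = 0 →
      x = φ T := by
    intro T x h1 h2 hx ex
    obtain ⟨-, hc, hm₀⟩ := hcoef T h1 h2
    obtain ⟨hφpos, eφ⟩ := hφ T h1 h2
    rw [hrew] at ex eφ
    exact fewnomial_root_unique s _ d p hc hm₀ hd hx hφpos ex eφ
  have hFx : ∀ T : ℝ, Tm < T → T < t j →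
      0 < ∑ m ∈ s, w m * ((d m : ℝ) * (φ T) ^ (d m - 1)) *
        (β j * (T - t j) ^ 2 * (T ^ 2 - t m ^ 2) - (T ^ 2 - t j ^ 2) * β m * (T - t m) ^ 2) := by
    intro T h1 h2
    obtain ⟨-, hc, hm₀⟩ := hcoef T h1 h2
    obtain ⟨hφpos, eφ⟩ := hφ T h1 h2
    rw [hrew] at eφ
    have hE := fewnomial_xderiv_pos s _ d p hc hm₀ hd hφpos eφ
    -- `x · F_x = ∑ dₘ cₘ x^{dₘ}`
    have key : (φ T) * ∑ m ∈ s, w m * ((d m : ℝ) * (φ T) ^ (d m - 1)) *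
        (β j * (T - t j) ^ 2 * (T ^ 2 - t m ^ 2) - (T ^ 2 - t j ^ 2) * β m * (T - t m) ^ 2)
        = ∑ m ∈ s, (d m : ℝ) * (w m * (β j * (T - t j) ^ 2 * (T ^ 2 - t m ^ 2) - (T ^ 2 - t j ^ 2) * β m * (T - t m) ^ 2)) * (φ T) ^ d m := by
      rw [Finset.mul_sum]
      refine Finset.sum_congr rfl fun m _ => ?_
      have e := SecularRolle.mul_natCast_mul_pow_pred (φ T) (d m)
      calc (φ T) * (w m * ((d m : ℝ) * (φ T) ^ (d m - 1)) * (β j * (T - t j) ^ 2 * (T ^ 2 - t m ^ 2) - (T ^ 2 - t j ^ 2) * β m * (T - t m) ^ 2))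
          = ((φ T) * ((d m : ℝ) * (φ T) ^ (d m - 1))) * (w m * (β j * (T - t j) ^ 2 * (T ^ 2 - t m ^ 2) - (T ^ 2 - t j ^ 2) * β m * (T - t m) ^ 2)) := by ring
        _ = ((d m : ℝ) * (φ T) ^ d m) * (w m * (β j * (T - t j) ^ 2 * (T ^ 2 - t m ^ 2) - (T ^ 2 - t j ^ 2) * β m * (T - t m) ^ 2)) := by rw [e]
        _ = (d m : ℝ) * (w m * (β j * (T - t j) ^ 2 * (T ^ 2 - t m ^ 2) - (T ^ 2 - t j ^ 2) * β m * (T - t m) ^ 2)) * (φ T) ^ d m := by ring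
    rw [← key] at hE
    exact pos_of_mul_pos_right hE hφpos.le
  refine ⟨φ, fun T h1 h2 => hφ T h1 h2, huniq, fun T h1 h2 => ⟨hFx T h1 h2, ?_⟩⟩
  -- the implicit derivative
  have hT' : ∀ T x : ℝ, HasDerivAt (fun T' : ℝ =>
      ∑ m ∈ s, w m * x ^ d m * (β j * (T' - t j) ^ 2 * (T' ^ 2 - t m ^ 2) - (T' ^ 2 - t j ^ 2) * β m * (T' - t m) ^ 2))
      (∑ m ∈ s, w m * x ^ d m * (β j * (2 * (T - t j)) * (T ^ 2 - t m ^ 2) + β j * (T - t j) ^ 2 * (2 * T)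
        - ((2 * T) * β m * (T - t m) ^ 2 + (T ^ 2 - t j ^ 2) * β m * (2 * (T - t m))))) T := by
    intro T x
    exact HasDerivAt.fun_sum fun m _ => (hasDerivAt_minorN (β m) (β j) (t m) (t j) T).const_mul (w m * x ^ d m)
  have hx' : ∀ T x : ℝ, HasDerivAt (fun x' : ℝ =>
      ∑ m ∈ s, w m * x' ^ d m * (β j * (T - t j) ^ 2 * (T ^ 2 - t m ^ 2) - (T ^ 2 - t j ^ 2) * β m * (T - t m) ^ 2))
      (∑ m ∈ s, w m * ((d m : ℝ) * x ^ (d m - 1)) *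
        (β j * (T - t j) ^ 2 * (T ^ 2 - t m ^ 2) - (T ^ 2 - t j ^ 2) * β m * (T - t m) ^ 2)) x := by
    intro T x
    exact HasDerivAt.fun_sum fun m _ =>
      (((hasDerivAt_pow (d m) x).const_mul (w m)).mul_const _)
  have cT : Continuous (fun q : ℝ × ℝ =>
      ∑ m ∈ s, w m * q.2 ^ d m * (β j * (2 * (q.1 - t j)) * (q.1 ^ 2 - t m ^ 2) + β j * (q.1 - t j) ^ 2 * (2 * q.1)
        - ((2 * q.1) * β m * (q.1 - t m) ^ 2 + (q.1 ^ 2 - t j ^ 2) * β m * (2 * (q.1 - t m))))) :=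
    continuous_finsetSum s fun m _ => by fun_prop
  have cx : Continuous (fun q : ℝ × ℝ =>
      ∑ m ∈ s, w m * ((d m : ℝ) * q.2 ^ (d m - 1)) *
        (β j * (q.1 - t j) ^ 2 * (q.1 ^ 2 - t m ^ 2) - (q.1 ^ 2 - t j ^ 2) * β m * (q.1 - t m) ^ 2)) :=
    continuous_finsetSum s fun m _ => by fun_prop
  have hF0 : ∀ T' ∈ Set.Ioo Tm (t j),
      ∑ m ∈ s, w m * (φ T') ^ d m * (β j * (T' - t j) ^ 2 * (T' ^ 2 - t m ^ 2) - (T' ^ 2 - t j ^ 2) * β m * (T' - t m) ^ 2) = 0 :=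
    fun T' hT' => (hφ T' hT'.1 hT'.2).2
  exact implicit_hasDerivAt_of_unique hT' hx' cT cx isOpen_Ioo hF0 (fun T' hT' => (hφ T' hT'.1 hT'.2).1)
    (fun T' hT' x hx0 ex => huniq T' x hT'.1 hT'.2 hx0 ex) (fun T' hT' => ne_of_gt (hFx T' hT'.1 hT'.2)) ⟨h1, h2⟩

end Summit.ValiantsHypothesis.ValiantsHypothesis.Theorems.LacunarySymmetroidMatrixDescartes.Pivot.CriticalWindows.Lone
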